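import Literature.NumberTheory.EllipticCurves.BirchFormulaQuadraticSigned
import Literature.NumberTheory.EllipticCurves.NonvanishingTwistsWaldspurgerOfHoffsteinLuo
import Literature.NumberTheory.EllipticCurves.ModularCurveRealPeriodProofs
import Literature.NumberTheory.EllipticCurves.ModularFormsGamma0Genus
import Literature.NumberTheory.EllipticCurves.ImaginaryPeriod
import Literature.NumberTheory.EllipticCurves.LeadingTermHeegnerProofs
import Literature.NumberTheory.EllipticCurves.HeightsBaseChangeProofs
import Literature.NumberTheory.EllipticCurves.RegulatorBasisProofs
import Literature.NumberTheory.EllipticCurves.MordellWeilTheoremProofs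
import HarnessLib

/-!
# Bookkeeping for the `ℚ`-descent of Gross–Zagier 1986, Thm. I.(7.3) (V.§2): minus periods,
# the twisted central value in the `Ω⁻_f`-currency, and heights

Proofs-only file (theorems only: no definition, no named fact, nothing restated; D-0026), the
first half of the reduction of the named fact
`Literature.NumberTheory.EllipticCurves.GrossZagier1986_thm_I_7_3` (`GrossZagierRationalPoint.lean`)
to the tree's primary facts, completed in `GrossZagierRationalPointProofs.lean`. It supplies the
three pieces of bookkeeping that Gross–Zagier use on pp. 312–313 of V.§2 to pass from
Thm. V.(2.1) over `K` to the statement `L'(E,1) = α·Ω·ĥ(P)`, `α ∈ ℚ^×`, over `ℚ`: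

* §1 `ModularParametrizationData.exists_int_maninConstant_mul_minusPeriod_eq` — the MINUS twin of
  the period relation `realPeriodRat_dvd` (`ModularCurveRealPeriodProofs`): for a parametrisation
  datum `(f, Λ_E, φ, c)` of `W/ℚ` (`cΛ_f ⊆ Λ_E`), `c · Ω⁻_f = k · |Ω⁻(W)|` with `k ∈ ℤ ∖ {0}`, where
  `im Λ_f = ℤ·Ω⁻_f/2` (`minusPeriod`, positive by `IsNewform0.minusPeriod_pos_holds`) and
  `Λ_E ∩ iℝ = iℤ|Ω⁻(W)|` (`imaginaryPeriodRat`, Pal's `Ω⁻`; `IsReal.exists_im_eq_int_mul_half`).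
  Edixhoven 1991 §1; Cremona 1997 §2.8, §2.10. (A Summits-side twin exists —
  `Summit.BirchSwinnertonDyer.Rank1Residual.Additive.exists_rat_mul_imaginaryPeriodRat_eq_minusPeriod`,
  `…/Additive/MinusPeriodRatio.lean` — which `Literature/` cannot import; this is its Literature home.)
* §2 `exists_rat_sqrt_mul_entireLFunction_quadraticTwist_one_eq` — for `d < 0` square-free,
  `d ≡ 1 (mod 4)`, `(d, N_W) = 1`: `√|d| · L(W^{(d)}, 1) = s · Ω⁻_f` with `s ∈ ℚ` (the rational
  symbol sum `∑ (a/|d|)[a/|d|]⁻_f`). This is "`L(E', 1) = β'Ω'`, `β' ∈ ℚ`, by modular symbols"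
  (GZ86 p. 312) in the currency that avoids the period of the twist altogether: Birch's formula for
  the odd character `(·/|d|)` with Gauss's sign (`ratMinusTwistedSymbolSum_jacobiChar_mul_minusPeriod`,
  Mazur–Tate–Teitelbaum 1986 (8.6)) and `aₙ(W^{(d)}) = (n/|d|)aₙ(f)`
  (`LFunction_quadraticTwist_apply_of_int_gcd_eq_one`). Modularity (`hasEntireLFunction_rat`) is the
  only named input.
* §3 heights: `canonicalHeight_add_of_isOfFinAddOrder` (`ĥ(P + T) = ĥ(P)`, `T` torsion),
  `exists_point_canonicalHeight_eq_two_mul` (for `σP − P` torsion, `σ` the reflection of a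
  quadratic `K`, the descended point `R ∈ E(ℚ)` with `ι R = P + σP` has `ĥ_ℚ(R) = 2ĥ_K(P)`; GZ86
  p. 313 "take `P = P_K + P̄_K ∈ E(ℚ)`"; Silverman VIII.5.4(b) for `ĥ_K ∘ ι = [K:ℚ]ĥ_ℚ`), and
  `exists_int_canonicalHeight_eq_sq_mul_regulator` (rank one: `ĥ(P) = n²·Reg`, from the tree's
  PROVED Mordell–Weil basis and `Reg = ĥ(P₀)`; GZ86 I.(7.2)–(7.3)).

## References
* [GrossZagier1986] B. H. Gross, D. B. Zagier, *Heegner points and derivatives of `L`-series*,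
  Invent. Math. 84 (1986), Thm. I.(7.3) p. 231, V.§2 pp. 310–313 (corpus `paper:url-d19484107fe2`).
* [MazurTateTeitelbaum1986Invent] B. Mazur, J. Tate, J. Teitelbaum, Invent. Math. 84 (1986), §I.8 (8.6).
* [EdixhovenManin1991] B. Edixhoven, *On the Manin constants of modular elliptic curves* (1991), §1.
* [CremonaAlgorithms1997] J. E. Cremona, *Algorithms for modular elliptic curves*, 2nd ed., §2.8, §2.10, §3.7.
* [Pal2012] V. Pal, Proc. AMS 140 (2012), p. 1514 (`Ω⁻`).
* [SilvermanAEC2009] J. H. Silverman, *The Arithmetic of Elliptic Curves*, 2nd ed., VIII.5.4(b), VIII.9.3.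
-/

noncomputable section

open scoped Classical MatrixGroups ModularForm NumberTheorySymbols

open Complex CongruenceSubgroup WeierstrassCurve NumberField

namespace Literature.NumberTheory.EllipticCurves

open ModularForms QuadraticFields

/-! ### §1 The imaginary period of the model and the minus period of the newform:
`c · Ω⁻_f = k · |Ω⁻(W)|`, `k ∈ ℤ ∖ {0}` -/

section MinusPeriod

variable {N : ℕ} (f : CuspForm (Gamma0 N) 2)

/-- If `Ω⁻_f > 0` (so `minusPeriod f` is not the junk value `0`) then `im Λ_f = ℤ · (Ω⁻_f/2)`, by
the definition of `minusPeriod` (twin of `realPeriods_eq_zmultiples_of_plusPeriod_pos`;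
Cremona §2.8). [cite: CremonaAlgorithms1997, §2.8 (p. 26)] -/
theorem imagPeriods_eq_zmultiples_of_minusPeriod_pos (h : 0 < minusPeriod f) :
    imagPeriods f = AddSubgroup.zmultiples (minusPeriod f / 2) := by
  classical
  have hex : ∃ Ω : ℝ, 0 < Ω ∧ imagPeriods f = AddSubgroup.zmultiples (Ω / 2) := by
    by_contra hex
    simp [minusPeriod, dif_neg hex] at h
  simp only [minusPeriod, dif_pos hex]
  exact hex.choose_spec.2

end MinusPeriod

namespace ModularForms.ModularParametrizationData

variable {W : WeierstrassCurve ℚ} {N : ℕ} [NeZero N] (D : ModularParametrizationData W N)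

/-- `|Ω⁻(W)|` is the least positive real period of the rotated Néron lattice `iΛ_E` of the datum
(`imaginaryPeriod_eq`: the lattice with `g₂ = c₄/12`, `g₃ = c₆/216` is unique). [cite: Pal2012, p. 1514] -/
theorem imaginaryPeriodRat_eq_minRealPeriod_mulLeft_I [W.IsElliptic] :
    W.imaginaryPeriodRat = (D.L.mulLeft I I_ne_zero).minRealPeriod := by
  haveI : (W.baseChange ℝ).IsElliptic := by
    rw [WeierstrassCurve.baseChange]; infer_instance
  rw [WeierstrassCurve.imaginaryPeriodRat_def]
  exact (W.baseChange ℝ).imaginaryPeriod_eq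
    (by rw [D.neronLattice_g₂, baseChange_real_c₄]) (by rw [D.neronLattice_g₃, baseChange_real_c₆])

/-- **The minus twin of the period relation `realPeriodRat_dvd`**: for a parametrisation datum
`D = (f, Λ_E, φ, c, deg)` of an elliptic `W/ℚ` there is a NON-ZERO integer `k` with
`c · Ω⁻_f = k · |Ω⁻(W)|`, where `Ω⁻_f = minusPeriod D.f` (`im Λ_f = ℤ · Ω⁻_f/2`) and
`|Ω⁻(W)| = W.imaginaryPeriodRat` (`Λ_E ∩ iℝ = iℤ|Ω⁻(W)|`). Proof: `Ω⁻_f > 0`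
(`IsNewform0.minusPeriod_pos_holds`), so some `z ∈ Λ_f` has `im z = Ω⁻_f/2`; `c z ∈ Λ_E`
(`smul_periodLattice_le`) and `im Λ_E ⊆ ℤ · |Ω⁻(W)|/2` (`IsReal.exists_im_eq_int_mul_half`);
`k ≠ 0` as `c ≠ 0` (`maninConstant_ne_zero_holds`). (Edixhoven 1991 §1; Cremona §2.8, §2.10; Summits-side
twin `Summit.BirchSwinnertonDyer.Rank1Residual.Additive.imaginaryPeriodRat_dvd_of_parametrization`.)
[cite: EdixhovenManin1991, §1] [cite: CremonaAlgorithms1997, §2.8 (p. 26)] -/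
theorem exists_int_maninConstant_mul_minusPeriod_eq [W.IsElliptic] :
    ∃ k : ℤ, k ≠ 0 ∧ (D.c : ℝ) * minusPeriod D.f = k * W.imaginaryPeriodRat := by
  have hpos : 0 < minusPeriod D.f :=
    IsNewform0.minusPeriod_pos_holds D.isNewformOf.1 D.isNewformOf.coeffField_eq_bot
  have him : imagPeriods D.f = AddSubgroup.zmultiples (minusPeriod D.f / 2) :=
    imagPeriods_eq_zmultiples_of_minusPeriod_pos D.f hpos
  have hmem : minusPeriod D.f / 2 ∈ imagPeriods D.f := by
    rw [him]
    exact AddSubgroup.mem_zmultiples _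
  rw [imagPeriods, AddSubgroup.mem_map] at hmem
  obtain ⟨z, hz, hzim⟩ := hmem
  have hzim' : z.im = minusPeriod D.f / 2 := by simpa using hzim
  have hcz : (D.c : ℂ) * z ∈ D.L.lattice := D.smul_periodLattice_le z hz
  obtain ⟨k, hk⟩ := D.isReal_neronLattice.exists_im_eq_int_mul_half hcz
  rw [← D.imaginaryPeriodRat_eq_minRealPeriod_mulLeft_I] at hk
  have hmul : ((D.c : ℂ) * z).im = (D.c : ℝ) * z.im := by
    rw [Complex.mul_im, Complex.intCast_re, Complex.intCast_im, zero_mul, add_zero]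
  rw [hmul, hzim'] at hk
  have hk' : (D.c : ℝ) * minusPeriod D.f = k * W.imaginaryPeriodRat := by linarith
  have hc : (D.c : ℝ) ≠ 0 := Int.cast_ne_zero.mpr D.maninConstant_ne_zero_holds
  refine ⟨k, ?_, hk'⟩
  rintro rfl
  rw [Int.cast_zero, zero_mul] at hk'
  exact mul_ne_zero hc hpos.ne' hk'

end ModularForms.ModularParametrizationData

/-! ### §2 The twisted central value in the minus-period currency:
`√|d| · L(E^{(d)}, 1) = s · Ω⁻_f`, `s ∈ ℚ` (Birch, odd `χ_d`, `d < 0` fundamental odd, `(d, N) = 1`) -/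

section TwistValue

/-- **`√|d| · L(E^{(d)}, 1) ∈ ℚ · Ω⁻_f` for an odd negative fundamental discriminant prime to the
conductor** (Manin–Drinfeld in Birch's form; Mazur–Tate–Teitelbaum 1986 §I.8 (8.6) with Gauss's
sign). For `W/ℚ` elliptic with newform `f`, `d < 0` square-free, `d ≡ 1 (mod 4)`, `(d, N_W) = 1`:
`a_n(W^{(d)}) = (n/|d|) a_n(f)` (`LFunction_quadraticTwist_apply_of_int_gcd_eq_one`), so
`L(W^{(d)}, s)` is the entire continuation of `L(f, χ_{|d|}, s)` with `χ_{|d|} = (·/|d|)` odd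
(`|d| ≡ 3 (mod 4)`), and the signed odd Birch formula
(`ratMinusTwistedSymbolSum_jacobiChar_mul_minusPeriod`) reads
`(∑_a (a/|d|)[a/|d|]⁻_f) · Ω⁻_f = √|d| · L(W^{(d)}, 1)` with a RATIONAL symbol sum. Requires the
entire continuation of the twist (`hE`, modularity). [cite: MazurTateTeitelbaum1986Invent, Ch. I §8 (8.6)]
[cite: GrossZagier1986, V.§2 (p. 312: "L(E', 1) = β'Ω' with β' ∈ ℚ by modular symbols")] -/
theorem exists_rat_sqrt_mul_entireLFunction_quadraticTwist_one_eq (hE : hasEntireLFunction_rat)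
    (W : WeierstrassCurve ℚ) [W.IsElliptic] {N : ℕ} [NeZero N] {f : CuspForm (Gamma0 N) 2}
    (hf : IsNewformOf W f) {d : ℤ} (hd0 : d < 0) (hsq : Squarefree d) (hd4 : d % 4 = 1)
    (hgcd : Int.gcd d (W.conductorNorm ℤ) = 1) :
    ∃ s : ℚ, (Real.sqrt (d.natAbs : ℝ) : ℂ) * (W.quadraticTwist (d : ℚ)).entireLFunction 1 =
      (s : ℂ) * (minusPeriod f : ℂ) := by
  set D : ℕ := d.natAbs with hDdef
  haveI : NeZero D := ⟨Int.natAbs_ne_zero.mpr hsq.ne_zero⟩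
  have hDd : (D : ℤ) = -d := by rw [hDdef]; omega
  have hD3 : D % 4 = 3 := by omega
  have hDsq : Squarefree D := Int.squarefree_natAbs.mpr hsq
  have hdq : (d : ℚ) ≠ 0 := by exact_mod_cast hsq.ne_zero
  haveI := W.isElliptic_quadraticTwist hdq
  have hEt : (W.quadraticTwist (d : ℚ)).HasEntireLFunction := hE _
  -- Dirichlet coefficients of the twist: `a_n(W^{(d)}) = (n/|d|) a_n(f)`
  have hco : ∀ n : ℕ, (((W.quadraticTwist (d : ℚ)).LFunction n : ℤ) : ℂ) =
      jacobiChar D n * cuspCoeff f n := fun n ↦ by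
    rw [LFunction_quadraticTwist_apply_of_int_gcd_eq_one W hd4 hsq hgcd n, Int.cast_mul,
      jacobiChar_natCast, hf.2 n]
  have hL' : ∀ s : ℂ, 2 < s.re →
      (W.quadraticTwist (d : ℚ)).entireLFunction s = twistedLSeries f (jacobiChar D) s := by
    intro s hs
    rw [(W.quadraticTwist (d : ℚ)).entireLFunction_eq_LSeries hEt (by linarith)]
    unfold WeierstrassCurve.LSeries twistedLSeries
    congr 1
    funext n
    exact hco n
  have hB := ratMinusTwistedSymbolSum_jacobiChar_mul_minusPeriod hf.1 hf.coeffField_eq_bot hDsq hD3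
    ((W.quadraticTwist (d : ℚ)).differentiable_entireLFunction hEt) hL'
  refine ⟨∑ a : ZMod D, (J((a.val : ℤ) | D) : ℚ) * ratMinusSymbol f ((a.val : ℚ) / D), ?_⟩
  rw [← hB, ratMinusTwistedSymbolSum]
  push_cast
  congr 1

end TwistValue

/-! ### §3 Heights: torsion translates, the point `P_K + P̄_K ∈ E(ℚ)`, and rank one -/

section Heights

open WeierstrassCurve.Affine.Point WeierstrassCurve.QuadraticDescent Module

/-- **`ĥ(P + T) = ĥ(P)` for a torsion point `T`** (any elliptic curve over a number field): with
`n = ord T`, `n(P + T) = nP`, so `n² ĥ(P + T) = n² ĥ(P)` by quadraticity (Silverman AEC VIII.9.3(b),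
tree `canonicalHeight_nsmul_holds`). [cite: SilvermanAEC2009, Thm. VIII.9.3(b)] -/
theorem canonicalHeight_add_of_isOfFinAddOrder {K : Type*} [Field K] [NumberField K]
    {V : WeierstrassCurve K} [V.IsElliptic] (P : V.toAffine.Point) {T : V.toAffine.Point}
    (hT : IsOfFinAddOrder T) : canonicalHeight (P + T) = canonicalHeight P := by
  set n := addOrderOf T with hn
  have hn0 : 0 < n := hT.addOrderOf_pos
  have hnT : n • T = 0 := addOrderOf_nsmul_eq_zero T
  have h1 := canonicalHeight_nsmul_holds (W := V) n (P + T)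
  have h2 := canonicalHeight_nsmul_holds (W := V) n P
  rw [nsmul_add, hnT, add_zero, h2] at h1
  have hn2 : (0 : ℝ) < (n : ℝ) ^ 2 := by positivity
  exact (mul_left_cancel₀ hn2.ne' h1).symm

/-- **The descended point and its height** (Gross–Zagier 1986, V.§2, p. 313: "If we take
`P = P_K + P̄_K ∈ E(ℚ)`, we must also replace `ĥ(P_K)` by `ĥ(P)/…`"). For a quadratic field `K`,
a non-trivial `σ : K →ₐ[ℚ] K` and `P ∈ E(K)` with `σP − P` torsion, there is `R ∈ E(ℚ)` (namely
`ι R = P + σP = 2P + (σP − P)`) with `ĥ_ℚ(R) = 2 · ĥ_K(P)`: `ĥ_K(ι R) = [K:ℚ] ĥ_ℚ(R)`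
(`canonicalHeight_baseChange`, Silverman VIII.5.4(b)) and `ĥ_K(2P + T) = 4 ĥ_K(P)`.
[cite: GrossZagier1986, V.§2 (p. 313)] [cite: SilvermanAEC2009, Prop. VIII.5.4(b)] -/
theorem exists_point_canonicalHeight_eq_two_mul (W : WeierstrassCurve ℚ) [W.IsElliptic]
    {K : Type*} [Field K] [NumberField K] (h2 : Module.finrank ℚ K = 2) {σ : K →ₐ[ℚ] K}
    (hσ : σ ≠ AlgHom.id ℚ K) {P : (W.baseChange K).toAffine.Point}
    (hT : IsOfFinAddOrder (conjMap W σ P - P)) :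
    ∃ R : W.toAffine.Point, canonicalHeight R = 2 * canonicalHeight P := by
  haveI : (W.baseChange K).IsElliptic := by rw [WeierstrassCurve.baseChange]; infer_instance
  have hσσ : ∀ z, σ (σ z) = z :=
    Literature.NumberTheory.EllipticCurves.Quadratic.apply_apply_of_ne_id h2 hσ
  set Q := P + conjMap W σ P with hQ
  have hQfix : conjMap W σ Q = Q := by
    rw [hQ, map_add, conjMap_conjMap W hσσ, add_comm]
  obtain ⟨R, hR⟩ := exists_incl_eq_of_conjMap_eq h2 W hσ hQfix
  refine ⟨R, ?_⟩
  -- `ĥ_K(Q) = ĥ_K(2P + (σP − P)) = 4 ĥ_K(P)`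
  have hQ' : Q = (2 : ℕ) • P + (conjMap W σ P - P) := by rw [hQ, two_nsmul]; abel
  have hhQ : canonicalHeight Q = 4 * canonicalHeight P := by
    rw [hQ', canonicalHeight_add_of_isOfFinAddOrder _ hT, canonicalHeight_nsmul_holds]
    norm_num
  -- `ĥ_K(ι R) = 2 ĥ_ℚ(R)`
  have hhR : canonicalHeight (incl K W R) = 2 * canonicalHeight R := by
    have h := canonicalHeight_baseChange (W := W) (K := ℚ) (L := K) R
    rw [h2] at h
    convert h using 2 <;> rfl
  have : 2 * canonicalHeight R = 4 * canonicalHeight P := by rw [← hhR, hR, hhQ]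
  linarith

/-- **Rank one: `ĥ(P) = n² · Reg(E/K)`** for every `P ∈ E(K)`, `n ∈ ℤ` (and `n ≠ 0` iff `P` has
infinite order). With a Mordell–Weil basis `{P₀}` (tree: `exists_isMordellWeilBasis_holds`,
Mordell–Weil proved), `Reg = det(⟨P₀, P₀⟩) = ĥ(P₀)` (`IsMordellWeilBasis.regulatorOf_eq_regulator`,
`heightPairing_self_holds`) and `P = nP₀ + T` with `T` torsion, so `ĥ(P) = n² ĥ(P₀)`.
(Gross–Zagier 1986, I.(7.2)–(7.3): the passage from `⟨P, P⟩` to the regulator `R` in rank one.)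
[cite: GrossZagier1986, I.(7.2)–(7.3) (p. 231)] [cite: SilvermanAEC2009, Thm. VIII.9.3] -/
theorem exists_int_canonicalHeight_eq_sq_mul_regulator {K : Type*} [Field K] [NumberField K]
    (V : WeierstrassCurve K) [V.IsElliptic] (hr : V.mordellWeilRank = 1) (P : V.toAffine.Point) :
    ∃ n : ℤ, canonicalHeight P = (n : ℝ) ^ 2 * V.regulator := by
  obtain ⟨B, hB⟩ := V.exists_isMordellWeilBasis_holds
  have hreg : regulatorOf B = V.regulator := hB.regulatorOf_eq_regulator
  generalize hr' : V.mordellWeilRank = r at B hB hreg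
  rw [hr] at hr'
  subst hr'
  -- the class of `P` in `E(K)/tors` is an integer multiple of the class of `B 0`
  have hmem : (QuotientAddGroup.mk P : mordellWeilModTorsion V) ∈
      Submodule.span ℤ (Set.range (QuotientAddGroup.mk ∘ B : Fin 1 → mordellWeilModTorsion V)) := by
    rw [hB.2]; exact Submodule.mem_top
  obtain ⟨c, hc⟩ := (Submodule.mem_span_range_iff_exists_fun ℤ).mp hmem
  rw [Fin.sum_univ_one] at hc
  set n : ℤ := c 0 with hn
  have hT : IsOfFinAddOrder (P - n • B 0) := by
    rw [← AddCommGroup.mem_torsion, ← QuotientAddGroup.eq_zero_iff, QuotientAddGroup.mk_sub,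
      QuotientAddGroup.mk_zsmul, sub_eq_zero]
    exact hc.symm
  refine ⟨n, ?_⟩
  have hP : P = n • B 0 + (P - n • B 0) := by abel
  rw [hP, canonicalHeight_add_of_isOfFinAddOrder _ hT, canonicalHeight_zsmul_holds, ← hreg,
    regulatorOf, Matrix.det_fin_one, heightPairingMatrix_apply, heightPairing_self_holds]

end Heights

end Literature.NumberTheory.EllipticCurves

end
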